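import Summits.CriticalPhenomena.PercolationContinuityZ3.Theorems.PercNearOneGluingNoHeavyLowerTailSahiGridPatternFlattening

/-!
# `NoHeavyLowerTail` (crux stmt-CriticalPhenomena-4575), Sahi programme P1: **THE COMBINED ALTERNATIVE** —
# rounding OR flattening: the pointwise disjunction of the two obligations already gives `PatternPos`

Support file (seat `prim-sahi-p1`, generation 13; `--supports stmt-CriticalPhenomena-4575`).  Pure proofs; one definition, the finite `Prop`
`CombinedAlternative n` (an obligation / hypothesis, never a fact); no `sorry`, standard axioms.

THE MATHEMATICS.  Two reductions of the pattern inequality are in the tree: the ROUNDING reduction (generation 12: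
`RoundingAlternative d → ResolvedPos d → PatternPos d`, terminal objects = twisted Boolean shadows) and the FLATTENING reduction (this generation:
`FlatteningDomination n → PatternPos n → PatternPos (n+1)`, terminal objects = cylinders).  They combine pointwise: call a triple of up-sets of
`[3]^{n+1}` GOOD if EITHER some simultaneous rounding on an UNRESOLVED axis does not increase `sStarD`, OR some flattening (any axis, any levels)
satisfies `6·sStarD(slices) ≤ sStarD`.  **`CombinedAlternative n`**: every up-set triple of `[3]^{n+1}` with an unresolved axis is good.  Then
(`patternPos_succ_of_combinedAlternative`) `CombinedAlternative n → ResolvedPos (n+1) → PatternPos n → PatternPos (n+1)`: induct on the number of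
unresolved axes — a flattening finishes at once by `PatternPos n`, a rounding lowers the count, and a fully resolved triple is handled by `ResolvedPos`.
`CombinedAlternative n` is implied by `RoundingAlternative (n+1)` and by `FlatteningDomination n` (`combinedAlternative_of_roundingAlternative`,
`combinedAlternative_of_flatteningDomination`), so it is the weakest obligation of the programme so far; iterating,
`(∀ n ≥ 3, CombinedAlternative n ∧ ResolvedPos (n+1)) → ∀ d, PatternPos d` (`forall_patternPos_of_combinedAlternative`).
WHY THIS MATTERS (seat census, generation 13): every PER-AXIS form of either alternative is FALSE at `d = 4` — the per-axis flattening domination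
(witness in `…Flattening`), and the per-axis rounding alternative 'L1' (witness `A = ↑{0210,0201,0111,0102,0012}`, `B = ↑{2200,1110,0210,2101,0201,1011,0121}`,
`C = ↑{2200,1210,1120,0220,2111,0211,2021,0121,1002,0102,0012}`: `sStarD = 379`, axis `0` unresolved, all `16` roundings on it give `≥ 380`) —
but in each witness the OTHER move type succeeds on the failing axis (flattening slack `13` on axis `0` of the rounding witness; a free single-owner
rounding on the failing axis of the flattening witness).  Nevertheless the per-axis COMBINED alternative is FALSE as well at `d = 4`
(seat census, later the same generation): `A = ↑{0021,0120,0201}` (a cylinder along axis `0`), `B = ↑{0012,0120,0202,1102,1111,1201,1210,2002,2020}`,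
`C = ↑{0011,0102,0201,1001,1200,2020,2110}` has `sStarD = 263`, axis `0` unresolved, all `16` roundings on axis `0` give `≥ 264` AND all `27`
flattenings along axis `0` give `6·sStarD ≥ 264` — so ONLY the '∃ axis' form below is a live obligation (its other axes have large negative gaps);
`CombinedAlternative n` (`n ≥ 3`), `PatternPos d` (`d ≥ 4`), Kahn's Conjecture 5 and Sahi's `C₃` remain OPEN and nothing here asserts them. [this work]
-/

namespace Summit.CriticalPhenomena.PercolationContinuityZ3.Theorems.SahiGridPattern

open Finset
open scoped Classical

variable {n : ℕ}

/-- A triple of `[3]^{n+1}` admits a DOMINATING FLATTENING: some axis (moved last by `τ`) and levels with `6·sStarD(slices) ≤ sStarD`. [this work] -/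
def HasFlattening (A B C : Finset (Pd (n + 1))) : Prop :=
  ∃ (τ : Equiv.Perm (Fin (n + 1))) (l m k : Fin 3),
    6 * sStarD (secLast l (A.map (compEquivD τ).toEmbedding)) (secLast m (B.map (compEquivD τ).toEmbedding))
        (secLast k (C.map (compEquivD τ).toEmbedding)) ≤ sStarD A B C

/-- A triple admits a NON-INCREASING ROUNDING on an unresolved axis. [this work] -/
def HasRounding (A B C : Finset (Pd (n + 1))) : Prop :=
  ∃ (a : Fin (n + 1)) (j : Fin 2) (sA sB sC : Bool), ¬ Resolved a A B C ∧
    sStarD (rnd sA a j A) (rnd sB a j B) (rnd sC a j C) ≤ sStarD A B C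

/-- **`CombinedAlternative n`**: every up-set triple of `[3]^{n+1}` with an unresolved axis admits a non-increasing rounding on an unresolved
axis OR a dominating flattening.  Implied by `RoundingAlternative (n+1)` and by `FlatteningDomination n`; an obligation / hypothesis, never a
fact. [this work] [status: open for n ≥ 3] -/
@[conjecture] def CombinedAlternative (n : ℕ) : Prop :=
  ∀ A B C : Finset (Pd (n + 1)), IsUpperSet (A : Set (Pd (n + 1))) → IsUpperSet (B : Set (Pd (n + 1))) →
    IsUpperSet (C : Set (Pd (n + 1))) → (∃ a, ¬ Resolved a A B C) → HasRounding A B C ∨ HasFlattening A B C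

/-- The rounding alternative implies the combined one. [this work] -/
theorem combinedAlternative_of_roundingAlternative (h : RoundingAlternative (n + 1)) : CombinedAlternative n :=
  fun A B C hA hB hC hex => Or.inl (h A B C hA hB hC hex)

/-- Flattening domination implies the combined alternative. [this work] -/
theorem combinedAlternative_of_flatteningDomination (h : FlatteningDomination n) : CombinedAlternative n :=
  fun A B C hA hB hC _ => Or.inr (h A B C hA hB hC)

/-- A dominating flattening finishes the argument one dimension down. [this work] -/
theorem sStarD_nonneg_of_hasFlattening (hP : PatternPos n) {A B C : Finset (Pd (n + 1))} (hA : IsUpperSet (A : Set (Pd (n + 1))))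
    (hB : IsUpperSet (B : Set (Pd (n + 1)))) (hC : IsUpperSet (C : Set (Pd (n + 1)))) (h : HasFlattening A B C) :
    0 ≤ sStarD A B C := by
  obtain ⟨τ, l, m, k, hle⟩ := h
  exact sStarD_nonneg_of_dominates hP (isUpperSet_secLast l (isUpperSet_map_compEquivD τ hA))
    (isUpperSet_secLast m (isUpperSet_map_compEquivD τ hB)) (isUpperSet_secLast k (isUpperSet_map_compEquivD τ hC)) (by norm_num) hle

/-- **THE COMBINED REDUCTION**: `CombinedAlternative n → ResolvedPos (n+1) → PatternPos n → PatternPos (n+1)` (induction on the number of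
unresolved axes: a flattening finishes at once, a rounding lowers the count, a resolved triple is `ResolvedPos`). [this work] -/
theorem patternPos_succ_of_combinedAlternative (hCA : CombinedAlternative n) (hRP : ResolvedPos (n + 1)) (hP : PatternPos n) :
    PatternPos (n + 1) := by
  suffices key : ∀ N : ℕ, ∀ A B C : Finset (Pd (n + 1)), IsUpperSet (A : Set (Pd (n + 1))) → IsUpperSet (B : Set (Pd (n + 1))) →
      IsUpperSet (C : Set (Pd (n + 1))) → (univ.filter fun a => ¬ Resolved a A B C).card ≤ N → 0 ≤ sStarD A B C by
    intro A B C hA hB hC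
    exact key _ A B C hA hB hC le_rfl
  intro N
  induction N with
  | zero =>
    intro A B C hA hB hC hN
    refine hRP A B C hA hB hC fun a => ?_
    by_contra hna
    have hmem : a ∈ univ.filter fun a => ¬ Resolved a A B C := by simp [hna]
    have : 0 < (univ.filter fun a => ¬ Resolved a A B C).card := card_pos.2 ⟨a, hmem⟩
    omega
  | succ N ih =>
    intro A B C hA hB hC hN
    by_cases hall : ∀ a, Resolved a A B C
    · exact hRP A B C hA hB hC hall
    · rcases hCA A B C hA hB hC (not_forall.1 hall) with ⟨a, j, sA, sB, sC, hna, hle⟩ | hflat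
      · have hsub : (univ.filter fun b => ¬ Resolved b (rnd sA a j A) (rnd sB a j B) (rnd sC a j C)) ⊆
            (univ.filter fun b => ¬ Resolved b A B C).erase a := by
          intro b hb
          simp only [mem_filter, mem_univ, true_and, mem_erase] at hb ⊢
          refine ⟨?_, ?_⟩
          · rintro rfl; exact hb (resolved_rnd b j sA sB sC hA hB hC)
          · intro hres
            by_cases hba : b = a
            · subst hba; exact hb (resolved_rnd b j sA sB sC hA hB hC)
            · exact hb (resolved_rnd_of_ne hba j sA sB sC hres)
        have hmem : a ∈ univ.filter fun b => ¬ Resolved b A B C := by simp [hna]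
        have hcard : (univ.filter fun b => ¬ Resolved b (rnd sA a j A) (rnd sB a j B) (rnd sC a j C)).card ≤ N := by
          have h1 := card_le_card hsub
          rw [card_erase_of_mem hmem] at h1
          omega
        exact (ih _ _ _ (isUpperSet_rnd sA a j hA) (isUpperSet_rnd sB a j hB) (isUpperSet_rnd sC a j hC) hcard).trans hle
      · exact sStarD_nonneg_of_hasFlattening hP hA hB hC hflat

/-- **Iterated**: the combined alternative together with resolved positivity in every dimension from `4` on gives the pattern inequality in
every dimension (kernel base `PatternPos ≤ 3`). [this work] -/
theorem forall_patternPos_of_combinedAlternative (h : ∀ n : ℕ, 3 ≤ n → CombinedAlternative n ∧ ResolvedPos (n + 1)) :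
    ∀ d, PatternPos d := by
  intro d
  induction d with
  | zero => exact patternPos_le_three_kernel (by norm_num)
  | succ m ih =>
    by_cases hm : m + 1 ≤ 3
    · exact patternPos_le_three_kernel hm
    · have h3 : 3 ≤ m := by omega
      exact patternPos_succ_of_combinedAlternative (h m h3).1 (h m h3).2 ih

/-- … hence Kahn's Conjecture 5. [this work] -/
theorem kahnConjecture_of_combinedAlternative (h : ∀ n : ℕ, 3 ≤ n → CombinedAlternative n ∧ ResolvedPos (n + 1)) : KahnConjecture :=
  kahnConjecture_of_forall_patternPos (forall_patternPos_of_combinedAlternative h)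

/-- The first open cell: `PatternPos 5` follows from the combined alternative on `[3]^5`, resolved positivity on `[3]^5` (twisted three-partition
positivity on five letters, a finite computation) and `PatternPos 4` — taken as the hypothesis `hP4`; in the tree `PatternPos 4` is CERTIFIED by exact
external computation (763 864 slice certificates, gen 8), not a kernel theorem. [this work] -/
theorem patternPos_five_of_combinedAlternative (hCA : CombinedAlternative 4) (hRP : ResolvedPos 5) (hP4 : PatternPos 4) : PatternPos 5 :=
  patternPos_succ_of_combinedAlternative hCA hRP hP4

end Summit.CriticalPhenomena.PercolationContinuityZ3.Theorems.SahiGridPattern
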